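import Mathlib

/-!
# STUB-PLAN companion — `stub_poorRigidCore` (crux `HyperoctahedralThreshold`, stmt-MatrixMultiplication-10883)
# typed targets of the merged plan `STUB-PLAN-stub_poorRigidCore.md` (stub-critic, planner-scrit-…-stub_poorRigid-0, 2026-08-16)

Conventions of the line: `μ c : Equiv.Perm (Fin n)` are the colours (fixed-point-free involutions), words `List (Fin 3)`
act on the right, `y · w := w.foldl (fun v c => μ c v) y`; reduced = `List.IsChain (· ≠ ·)`; the core's conclusion format
(`∃ k p q col, …`) is that of `stub_poorRigidCore` (`Lines/refutation_local_symmetry.lean:271`, restated verbatim as `Stub`).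

Contents (statements only; every `sorry` is a target named in the plan, nothing is claimed proved here):
* `RootAtom`      — THE residual atom of the merged plan (plan §3, target T5): at a ROOT RUNG `(v, x)` of the prover's choice,
                    outside an ABSORBING forbidden set `F ⊇ R` of the prover's choice, the mutually J-defective colliding pairs of
                    `F`-avoiding self-clean reduced words of length `a` (`2a ≤ n^(1/4)`) are beaten by the Cauchy–Schwarz floor —
                    OR the core's conclusion holds outright (structure exits).  `stub_rootAtom : RootAtom`.
* `GoodCollisionWalk` — extraction (plan T3 = ideator-3's H3 verbatim): one colliding, `R`-free, all-rungs-equal-or-disjoint pair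
                    of distinct reduced words from a rung gives the conclusion with `k + 1 ≤ 2a`.
* `stub_rootCensus : RootAtom → GoodCollisionWalk → Stub` — the reduction (plan T4; Cauchy–Schwarz on the endpoint map + T3).
* `stub_rootTypicalSum`, `stub_rootSelfCleanSum` — the two Markov numerators (plan T1, T2) that make `Φ` large at a typical root:
                    `F`-avoidance costs `≤ 2(a+1)|F|·n·|W_a|` root–word incidences (bijection trick), self-uncleanness costs
                    `≤ (a+1)²·n·|W_a|·(Φ₀+1)` under the fixed-point bound `Φ₀` that POOR supplies (`stub_poorUniform`, tree).
-/

set_option linter.unusedVariables false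
set_option linter.dupNamespace false

namespace Summit.MatrixMultiplication.MatrixMultiplication.Cruxes.HyperoctahedralThreshold.StubPlan

open Finset

/-- verbatim copy of the registered stub `stub_poorRigidCore` (`Lines/refutation_local_symmetry.lean:271`, 1345 chars after the colon;
the 900-char payload copy handed to siege seats is TRUNCATED and false — siege k28/k3/k24). -/
def Stub : Prop :=
  ∃ n₀ : ℕ, ∀ n ≥ n₀, ∀ μ : Fin 3 → Equiv.Perm (Fin n), (∀ i, μ i * μ i = 1 ∧ ∀ v, μ i v ≠ v) → ∀ R : Finset (Fin n), (R.card : ℝ) ≤ (n : ℝ) ^ ((3 : ℝ) / 4) → (∀ z : List (Fin 3), z ≠ [] → List.IsChain (· ≠ ·) (z ++ z) → (z.length : ℝ) ≤ (n : ℝ) ^ ((1 : ℝ) / 4) → ∀ (m : ℕ) (x : Fin m → Fin n), Function.Injective x → (∀ i, z.foldl (fun v c => μ c v) (x i) = x i) → m ≤ (4 * z.length ^ 2) ^ (Nat.log 2 z.length + 1) * (R.card + 1)) → (∀ z : List (Fin 3), z ≠ [] → List.IsChain (· ≠ ·) (z ++ z) → (z.length : ℝ) ≤ (n : ℝ) ^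 ((1 : ℝ) / 4) → ∀ (m : ℕ) (x : Fin m → Fin n), Function.Injective x → (∀ i, z.foldl (fun v c => μ c v) (x i) = x i) → (∀ i j, ∀ s t : Fin z.length, ((z.take (s : ℕ)).foldl (fun v c => μ c v) (x i) = (z.take (t : ℕ)).foldl (fun v c => μ c v) (x i) ↔ (z.take (s : ℕ)).foldl (fun v c => μ c v) (x j) = (z.take (t : ℕ)).foldl (fun v c => μ c v) (x j))) → m ≤ 2 * (z.length * R.card) + z.length ^ 2 + 1) → ∃ (k : ℕ) (p q : Fin (k + 1) → Fin n) (col : Fin (k + 1) → Fin 3), (∀ i, p i ≠ q i) ∧ (∀ i, (μ (col i) (p i) = p (i + 1) ∧ μ (col i) (q i) = q (i + 1)) ∨ (μ (col i) (p i) = q (i + 1) ∧ μ (col i) (q i) = p (i + 1))) ∧ (∀ i, col i ≠ col (i + 1)) ∧ (∀ i j, (p i = p j ∧ q i = q j) ∨ (p i = q j ∧ q i = p j) ∨ (p i ≠ p j ∧ p i ≠ q j ∧ q i ≠ p j ∧ q i ≠ q j)) ∧ (∀ i, p i ∉ R ∧ q i ∉ R) ∧ ((k : ℝ) + 1) ≤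 (n : ℝ) ^ ((1 : ℝ) / 4)

open Classical in
/-- **RootAtom** (plan §3, T5 — register as `stub_rootAtom` with this body).  For large `n`, fpf involutions, `|R| ≤ n^(3/4)`, POOR and
RIGID (both verbatim from the stub; RIGID ⇒ POOR is the tree's `stub_poorOfRigid`): EITHER the core's conclusion holds for `R`
(right-hand exits: `R`-free colour-closed piece, near-involution `stub_nearSymmetryCore`, deck/large-order symmetry, big pattern class
`stub_patternTwin`, rich word `richDescent`, a clean pair inside a heavy cell …), OR there are an absorbing set `F ⊇ R`, a depth `a` with
`2a ≤ ⌊n^(1/4)⌋₊` and a root rung `v ≠ x` such that, with `Φ` = the reduced words of length `a` whose two trajectories from `v` and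
from `x` avoid `F` at all times `t ≤ a` and whose own rungs are pairwise equal/swapped/disjoint (self-clean), the ordered pairs of
DISTINCT members of `Φ` that collide as ordered pairs (`v·β = v·β'`, `x·β = x·β'`) and are NOT mutually clean number fewer than
`|Φ|²/n² − |Φ|` (the Cauchy–Schwarz floor for colliding pairs):  `n² · (|Φ| + #Bad) < |Φ|²`. -/
def RootAtom : Prop :=
  ∃ n₀ : ℕ, ∀ n ≥ n₀, ∀ μ : Fin 3 → Equiv.Perm (Fin n), (∀ i, μ i * μ i = 1 ∧ ∀ v, μ i v ≠ v) → ∀ R : Finset (Fin n), (R.card : ℝ) ≤ (n : ℝ) ^ ((3 : ℝ) / 4) → (∀ z : List (Fin 3), z ≠ [] → List.IsChain (· ≠ ·) (z ++ z) → (z.length : ℝ) ≤ (n : ℝ) ^ ((1 : ℝ) / 4) → ∀ (m : ℕ) (x : Fin m → Fin n), Function.Injective x → (∀ i, z.foldl (fun v c => μ c v) (x i) = x i) → m ≤ (4 * z.length ^ 2) ^ (Nat.log 2 z.length + 1) * (R.card + 1)) → (∀ z : List (Fin 3), z ≠ [] → List.IsChain (· ≠ ·) (z ++ z) → (z.length :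 ℝ) ≤ (n : ℝ) ^ ((1 : ℝ) / 4) → ∀ (m : ℕ) (x : Fin m → Fin n), Function.Injective x → (∀ i, z.foldl (fun v c => μ c v) (x i) = x i) → (∀ i j, ∀ s t : Fin z.length, ((z.take (s : ℕ)).foldl (fun v c => μ c v) (x i) = (z.take (t : ℕ)).foldl (fun v c => μ c v) (x i) ↔ (z.take (s : ℕ)).foldl (fun v c => μ c v) (x j) = (z.take (t : ℕ)).foldl (fun v c => μ c v) (x j))) → m ≤ 2 * (z.length * R.card) + z.length ^ 2 + 1) → (∃ (k : ℕ) (p q : Fin (k + 1) → Fin n) (col : Fin (k + 1) → Fin 3), (∀ i, p i ≠ q i) ∧ (∀ i, (μ (col i) (p i) = p (i + 1) ∧ μ (col i) (q i) = q (i + 1)) ∨ (μ (col i) (p i) = q (i + 1) ∧ μ (col i) (q i) = p (i + 1))) ∧ (∀ i, col i ≠ col (i + 1)) ∧ (∀ i j, (p i = p j ∧ q i = q j) ∨ (p i = q j ∧ q i = p j) ∨ (p i ≠ p j ∧ p i ≠ q j ∧ q i ≠ p j ∧ q i ≠ q j)) ∧ (∀ i, p i ∉ R ∧ q i ∉ R)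 ∧ ((k : ℝ) + 1) ≤ (n : ℝ) ^ ((1 : ℝ) / 4)) ∨ ∃ (F : Finset (Fin n)) (a : ℕ) (v x : Fin n), R ⊆ F ∧ v ≠ x ∧ 2 * a ≤ ⌊(n : ℝ) ^ ((1 : ℝ) / 4)⌋₊ ∧ (let Φ : Finset (List (Fin 3)) := (((Finset.univ : Finset (List.Vector (Fin 3) a)).image List.Vector.toList).filter (fun β => List.IsChain (· ≠ ·) β ∧ (∀ t ≤ a, (β.take t).foldl (fun w d => μ d w) v ∉ F ∧ (β.take t).foldl (fun w d => μ d w) x ∉ F) ∧ (∀ s ≤ a, ∀ t ≤ a, ((((β.take s).foldl (fun w d => μ d w) v) = ((β.take t).foldl (fun w d => μ d w) v) ∧ ((β.take s).foldl (fun w d => μ d w) x) = ((β.take t).foldl (fun w d => μ d w) x)) ∨ (((β.take s).foldl (fun w d => μ d w) v) = ((β.take t).foldl (fun w d => μ d w) x) ∧ ((β.take s).foldl (fun w d => μ d w) x) = ((β.take t).foldl (fun w d => μ d w) v)) ∨ (((β.take s).foldl (fun w d => μ d w) v) ≠ ((β.take t).foldl (fun w d => μ d w) v) ∧ ((β.take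 s).foldl (fun w d => μ d w) v) ≠ ((β.take t).foldl (fun w d => μ d w) x) ∧ ((β.take s).foldl (fun w d => μ d w) x) ≠ ((β.take t).foldl (fun w d => μ d w) v) ∧ ((β.take s).foldl (fun w d => μ d w) x) ≠ ((β.take t).foldl (fun w d => μ d w) x)))))); n ^ 2 * (Φ.card + ((Φ ×ˢ Φ).filter (fun b => b.1 ≠ b.2 ∧ b.1.foldl (fun w d => μ d w) v = b.2.foldl (fun w d => μ d w) v ∧ b.1.foldl (fun w d => μ d w) x = b.2.foldl (fun w d => μ d w) x ∧ ¬ (∀ s ≤ a, ∀ t ≤ a, ((((b.1.take s).foldl (fun w d => μ d w) v) = ((b.2.take t).foldl (fun w d => μ d w) v) ∧ ((b.1.take s).foldl (fun w d => μ d w) x) = ((b.2.take t).foldl (fun w d => μ d w) x)) ∨ (((b.1.take s).foldl (fun w d => μ d w) v) = ((b.2.take t).foldl (fun w d => μ d w) x) ∧ ((b.1.take s).foldl (fun w d => μ d w) x) = ((b.2.take t).foldl (fun w d => μ d w) v)) ∨ (((b.1.take s).foldl (fun w d => μ d w) v) ≠ ((b.2.take t).foldl (fun w d => μ d w) v) ∧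 ((b.1.take s).foldl (fun w d => μ d w) v) ≠ ((b.2.take t).foldl (fun w d => μ d w) x) ∧ ((b.1.take s).foldl (fun w d => μ d w) x) ≠ ((b.2.take t).foldl (fun w d => μ d w) v) ∧ ((b.1.take s).foldl (fun w d => μ d w) x) ≠ ((b.2.take t).foldl (fun w d => μ d w) x)))))).card) < Φ.card ^ 2)

/-- **GoodCollisionWalk** (plan T3 = STUB-IDEAS k3 `H3_goodCollision_cleanWalk`, verbatim): a colliding pair of distinct reduced words
of length `a` from the rung `(v, x)`, `R`-free, all `2(a+1)` rungs pairwise equal/swapped/disjoint (within each word and across), yields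
the conclusion with `k + 1 ≤ 2a` (trim common prefix/suffix as in the tree's `TwinSupply.cyclic_of_collision`, but KEEPING trajectory
containment, then `SameColourTip.twin_cleanWalk` / `PatternRefl.patternPair_cleanWalk`). -/
def GoodCollisionWalk : Prop :=
  ∀ (n a : ℕ) (μ : Fin 3 → Equiv.Perm (Fin n)) (R : Finset (Fin n))
    (v x : Fin n) (β β' : List (Fin 3)), (∀ b, μ b * μ b = 1) → v ≠ x → β.length = a → β'.length = a → β ≠ β' →
    List.IsChain (· ≠ ·) β → List.IsChain (· ≠ ·) β' →
    β.foldl (fun v b => μ b v) v = β'.foldl (fun v b => μ b v) v → β.foldl (fun v b => μ b v) x = β'.foldl (fun v b => μ b v) x →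
    (∀ t ≤ a, (β.take t).foldl (fun v b => μ b v) v ∉ R ∧ (β.take t).foldl (fun v b => μ b v) x ∉ R ∧
      (β'.take t).foldl (fun v b => μ b v) v ∉ R ∧ (β'.take t).foldl (fun v b => μ b v) x ∉ R) →
    (∀ γ γ' : List (Fin 3), (γ = β ∨ γ = β') → (γ' = β ∨ γ' = β') → ∀ s ≤ a, ∀ t ≤ a,
      ((γ.take s).foldl (fun v b => μ b v) v = (γ'.take t).foldl (fun v b => μ b v) v ∧
          (γ.take s).foldl (fun v b => μ b v) x = (γ'.take t).foldl (fun v b => μ b v) x) ∨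
        ((γ.take s).foldl (fun v b => μ b v) v = (γ'.take t).foldl (fun v b => μ b v) x ∧
          (γ.take s).foldl (fun v b => μ b v) x = (γ'.take t).foldl (fun v b => μ b v) v) ∨
        ((γ.take s).foldl (fun v b => μ b v) v ≠ (γ'.take t).foldl (fun v b => μ b v) v ∧
          (γ.take s).foldl (fun v b => μ b v) v ≠ (γ'.take t).foldl (fun v b => μ b v) x ∧
          (γ.take s).foldl (fun v b => μ b v) x ≠ (γ'.take t).foldl (fun v b => μ b v) v ∧
          (γ.take s).foldl (fun v b => μ b v) x ≠ (γ'.take t).foldl (fun v b => μ b v) x)) →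
    ∃ (k : ℕ) (p q : Fin (k + 1) → Fin n) (col : Fin (k + 1) → Fin 3), (∀ i, p i ≠ q i) ∧
      (∀ i, (μ (col i) (p i) = p (i + 1) ∧ μ (col i) (q i) = q (i + 1)) ∨ (μ (col i) (p i) = q (i + 1) ∧ μ (col i) (q i) = p (i + 1))) ∧
      (∀ i, col i ≠ col (i + 1)) ∧
      (∀ i j, (p i = p j ∧ q i = q j) ∨ (p i = q j ∧ q i = p j) ∨ (p i ≠ p j ∧ p i ≠ q j ∧ q i ≠ p j ∧ q i ≠ q j)) ∧
      (∀ i, p i ∉ R ∧ q i ∉ R) ∧ k + 1 ≤ 2 * a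

/-- T5 — THE ATOM (open; size XL).  Register verbatim (body of `RootAtom`). -/
theorem stub_rootAtom : RootAtom := by
  sorry

/-- T3 — extraction with trajectory containment (size M; register verbatim, body of `GoodCollisionWalk`). -/
theorem stub_goodCollisionWalk : GoodCollisionWalk := by
  sorry

/-- T4 — THE REDUCTION (size S–M; register verbatim with both hypotheses unfolded): Cauchy–Schwarz on `β ↦ (v·β, x·β) : Φ → Fin n × Fin n`
(`SameColourSupply.card_sq_le_card_mul_collisions`, tree file `…WordCollisions`, `Y := univ ×ˢ univ`) gives `|Φ|² ≤ n²·(|Φ| + #colliding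
ordered pairs of distinct members)`, so `#Bad < #colliding` and some colliding pair is mutually clean; both members are self-clean and `F`-free, hence
`R`-free (`R ⊆ F`); `GoodCollisionWalk` gives the conclusion with `k + 1 ≤ 2a ≤ n^(1/4)`.  The left disjunct of `RootAtom` is the
conclusion itself. -/
theorem stub_rootCensus : RootAtom → GoodCollisionWalk → Stub := by
  sorry

open Classical in
/-- T1 — `F`-avoidance numerator (size S; bijection trick `y ↦ y · β.take t`): summed over ALL ordered roots `(v, x)`, the reduced words
of length `a` one of whose two trajectories meets `F` number at most `2(a+1)·|F|·n·(3·2^a)`.  With T2 and Markov: for `|F| ≤ n/(64(a+1))`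
and `n ≥ n₁(a)`, at least `n²/2` ordered roots have `|Φ_F(v,x,a)| ≥ |W_a|/2 ≥ (3/4)·2^a` (plan §2 T1–T2). -/
theorem stub_rootTypicalSum : ∀ (n a : ℕ) (μ : Fin 3 → Equiv.Perm (Fin n)) (F : Finset (Fin n)), (∀ b, μ b * μ b = 1) →
    ∑ v : Fin n, ∑ x : Fin n, (((Finset.univ : Finset (List.Vector (Fin 3) a)).image List.Vector.toList).filter (fun β => List.IsChain (· ≠ ·) β ∧
        ¬ (∀ t ≤ a, (β.take t).foldl (fun w d => μ d w) v ∉ F ∧ (β.take t).foldl (fun w d => μ d w) x ∉ F))).card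
      ≤ 2 * (a + 1) * F.card * n * (3 * 2 ^ a) := by
  sorry

open Classical in
/-- T2 — self-cleanness numerator (size M; POOR pays): if every nonempty reduced word of length `≤ a` has `≤ Φ₀` fixed points
(`stub_poorUniform` turns the core's POOR hypothesis into this with `Φ₀ = (4a²)^(⌊log₂ a⌋+1)(|R|+1) = n^(3/4+o(1))`), then summed over all
ordered roots `(v, x)` the reduced words of length `a` that are NOT self-clean from `(v, x)` number at most `(a+1)²·n·(3·2^a)·(Φ₀+1)`:
a coincidence `v·β_[s] = v·β_[t]` puts `v·β_[s]` in `Fix β_(s,t]` (fibre `≤ Φ₀` over `(β, s, t)`, times `n` choices of `x`), the same on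
the `x`-side, and a cross coincidence `v·β_[s] = x·β_[t]` (`s ≠ t`) determines `x` from `(v, β)`.  Cf. the tree's dart version
`SelfCleanDarts.card_selfUnclean_le` (roots = `c`-edges). -/
theorem stub_rootSelfCleanSum : ∀ (n a Φ₀ : ℕ) (μ : Fin 3 → Equiv.Perm (Fin n)), (∀ b, μ b * μ b = 1) → (∀ b w, μ b w ≠ w) → 1 ≤ a →
    (∀ w : List (Fin 3), w ≠ [] → List.IsChain (· ≠ ·) w → w.length ≤ a →
      ((Finset.univ : Finset (Fin n)).filter (fun y => w.foldl (fun v b => μ b v) y = y)).card ≤ Φ₀) →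
    ∑ v : Fin n, ∑ x : Fin n, (((Finset.univ : Finset (List.Vector (Fin 3) a)).image List.Vector.toList).filter (fun β => List.IsChain (· ≠ ·) β ∧
        ¬ (∀ s ≤ a, ∀ t ≤ a, ((((β.take s).foldl (fun w d => μ d w) v) = ((β.take t).foldl (fun w d => μ d w) v) ∧ ((β.take s).foldl (fun w d => μ d w) x) = ((β.take t).foldl (fun w d => μ d w) x)) ∨ (((β.take s).foldl (fun w d => μ d w) v) = ((β.take t).foldl (fun w d => μ d w) x) ∧ ((β.take s).foldl (fun w d => μ d w) x) = ((β.take t).foldl (fun w d => μ d w) v)) ∨ (((β.take s).foldl (fun w d => μ d w) v) ≠ ((β.take t).foldl (fun w d => μ d w) v) ∧ ((β.take s).foldl (fun w d => μ d w) v) ≠ ((β.take t).foldl (fun w d => μ d w) x) ∧ ((β.take s).foldl (fun w d => μ d w) x) ≠ ((β.take t).foldl (fun w d => μ d w) v) ∧ ((β.take s).foldl (fun w d => μ d w) x) ≠ ((β.take t).foldl (fun w d => μ d w) x)))))).card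
      ≤ (a + 1) ^ 2 * n * (3 * 2 ^ a) * (Φ₀ + 1) := by
  sorry

end Summit.MatrixMultiplication.MatrixMultiplication.Cruxes.HyperoctahedralThreshold.StubPlan
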